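import Summits.CriticalPhenomena.Ising3D.Control2DOpeEpsTwoSided
import Mathlib.Analysis.SpecialFunctions.Pow.Real
import Mathlib.Analysis.Complex.ExponentialBounds
import Mathlib.Topology.Algebra.InfiniteSum.Real
import Mathlib.Tactic.Linarith
import Mathlib.Tactic.Positivity
import HarnessLib

/-!
# The 2D Ising blind control: the `ε` OPE datum two-sided (kind `ope2eps`) — assembly, rungs, decimals
(cell `pub-ising3x`, seat controls-1 gen 13; `SCOPE.md` §4 `### controls-1 v14` ADDENDUM 1 / `v15`, round RB-6)

HONEST FRAMING: lottery ticket; floor = tightest certified 3D Ising CFT bounds; no exact-solution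
claim without a proof. CONTROL-ONLY: the two-dimensional axiom set `A2D′` is NOT the three-dimensional
floor's axiom set.

`Control2DOpeEpsTwoSided.lean` types the kind-`ope2eps` statements `OpeEpsLowerA2D` / `OpeEpsUpperA2D`
(`P̃_lo < W`, `W < P̃_hi` for the weighted in-box scalar content `W = ∑_{box} p_i 2^{-Δ_i}`) and proves
their soundness for evaluation-continuous functionals. This file PROVES the elementary assembly that
`HOME/code/controls/rb6/cover_eps.py` performs on exact rationals:
* `CrossingData.boxCoeff_pinch` — on the box `2^{-e₂} ≤ 2^{-Δ_i} ≤ 2^{-e₁}`, so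
  `2^{e₁} W ≤ p_box ≤ 2^{e₂} W` (`p_box = ∑_{box} p_i`, summable as soon as `W` is);
* `pBoxTwoSided_of_bounds` — a pair of certificates with `P̃_lo ≥ 0` gives the typed two-sided statement
  `PBoxTwoSided … (2^{e₁} P̃_lo) (2^{e₂} P̃_hi)` (`W > P̃_lo ≥ 0` forces summability); `PBoxTwoSided.mono`;
  `lambdaSqBox_bounds` for the standard-normalisation datum `λ²_{σσ[box]} = 2 p_box`;
* the rungs `pBoxTwoSided_rb6_L11` / `pBoxTwoSided_rb6_L15` with the numbers of
  `RB6/cover_eps_L11.json` / `cover_eps_L15.json` as HYPOTHESES (external facts: each certificate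
  PASSES reader A `verify_A2d.py 2.5.x --backend arb` AND reader B `verify_B2d.py 2.4.x --bernstein int`);
* decimal sanity: `19793/10000 < 2^{197/200}` (exact check `1.9793^200 < 2^197`) and
  `2^{20001/20000} < 200007/100000` (via `Real.exp_bound_div_one_sub_of_interval'` and
  `Real.log_two_lt_d9`), hence at Λ = 15: `0.123674 < p_box < 0.127625`, i.e.
  `0.247348 < λ²_{σσ[box]} < 0.25525` — the 2D Ising values `p_ε = 1/8`, `λ²_{σσε} = 1/4` inside.

NOTHING numerical about a functional is asserted here. Sources: sum rule and linear-functional logic,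
R. Rattazzi, V. S. Rychkov, E. Tonni, A. Vichi, JHEP 12 (2008) 031, §3–§5. Tree: `CrossingData`,
`IsUnitary`, `SatisfiesCrossing` (`Control2DBootstrap.lean`), `ScalarsIn`, `SpinTwoIn`
(`Control2DIsland.lean`), `boxSet`, `boxWeight`, `boxCoeff`, `lambdaSqBox`, `OpeEpsLowerA2D`,
`OpeEpsUpperA2D` (`Control2DOpeEpsTwoSided.lean`); Mathlib `Real.rpow`, `tsum`.
-/

namespace Summit.CriticalPhenomena.Ising3D.Control2D

open Set
open Literature.MathematicalPhysics.QuantumFieldTheory.ConformalBootstrap3D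

/-! ### From two-sided `W` to two-sided `p_box` (and `λ²`) -/

/-- **The two-sided in-box OPE control statement.** `PBoxTwoSided s G δ e₁ e₂ lo hi`: every
parity-symmetric unitary solution of the 2D `⟨σσσσ⟩` sum rule at `Δ_σ = s` satisfying `A2D′` with the
`ε` box `[e₁, e₂]` has total in-box scalar coefficient `lo < p_box < hi` (tree normalisation;
`λ²_{σσ[box]} = 2 p_box`). CONTROL-ONLY. [cite: RattazziEtAl2008, §5] -/
def PBoxTwoSided (s G δ e₁ e₂ lo hi : ℝ) : Prop :=
  ∀ D : CrossingData, D.IsUnitary → D.SatisfiesCrossing s →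
    D.ScalarsIn (Icc e₁ e₂ ∪ Ici G) → D.SpinTwoIn ({2} ∪ Ici (2 + δ)) →
      lo < D.boxCoeff e₁ e₂ ∧ D.boxCoeff e₁ e₂ < hi

/-- Weakening the interval preserves the statement. Elementary. [folklore] -/
theorem PBoxTwoSided.mono {s G δ e₁ e₂ lo hi lo' hi' : ℝ} (h : PBoxTwoSided s G δ e₁ e₂ lo hi)
    (hlo : lo' ≤ lo) (hhi : hi ≤ hi') : PBoxTwoSided s G δ e₁ e₂ lo' hi' := by
  intro D hU hC hS hT2
  obtain ⟨h1, h2⟩ := h D hU hC hS hT2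
  exact ⟨lt_of_le_of_lt hlo h1, lt_of_lt_of_le h2 hhi⟩

/-- On the box the weight is pinched: `2^{e₁} 2^{-Δ} ≤ 1 ≤ 2^{e₂} 2^{-Δ}` for `e₁ ≤ Δ ≤ e₂`.
Elementary. [folklore] -/
theorem rpow_weight_pinch {e₁ e₂ Δ : ℝ} (h₁ : e₁ ≤ Δ) (h₂ : Δ ≤ e₂) :
    (2 : ℝ) ^ e₁ * (2 : ℝ) ^ (-Δ) ≤ 1 ∧ 1 ≤ (2 : ℝ) ^ e₂ * (2 : ℝ) ^ (-Δ) := by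
  have h2 : (0 : ℝ) < 2 := by norm_num
  rw [← Real.rpow_add h2, ← Real.rpow_add h2]
  constructor
  · calc (2 : ℝ) ^ (e₁ + -Δ) ≤ (2 : ℝ) ^ (0 : ℝ) :=
          Real.rpow_le_rpow_of_exponent_le (by norm_num) (by linarith)
      _ = 1 := Real.rpow_zero 2
  · calc (1 : ℝ) = (2 : ℝ) ^ (0 : ℝ) := (Real.rpow_zero 2).symm
      _ ≤ (2 : ℝ) ^ (e₂ + -Δ) := Real.rpow_le_rpow_of_exponent_le (by norm_num) (by linarith)

/-- **`p_box` against `W`**: if the weighted content `W` is summable then so is `p_box`, and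
`2^{e₁} W ≤ p_box ≤ 2^{e₂} W`. Elementary (termwise comparison of unconditional sums). [folklore] -/
theorem CrossingData.boxCoeff_pinch (D : CrossingData) (e₁ e₂ : ℝ) (hU : D.IsUnitary)
    (hW : Summable ((D.boxSet e₁ e₂).indicator fun i => D.p i * (2 : ℝ) ^ (-D.Δ i))) :
    Summable ((D.boxSet e₁ e₂).indicator D.p) ∧
      (2 : ℝ) ^ e₁ * D.boxWeight e₁ e₂ ≤ D.boxCoeff e₁ e₂ ∧
        D.boxCoeff e₁ e₂ ≤ (2 : ℝ) ^ e₂ * D.boxWeight e₁ e₂ := by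
  set B := D.boxSet e₁ e₂ with hB
  set w : D.ι → ℝ := B.indicator fun i => D.p i * (2 : ℝ) ^ (-D.Δ i) with hw_def
  set q : D.ι → ℝ := B.indicator D.p with hq_def
  have hqnn : ∀ i, 0 ≤ q i := fun i => Set.indicator_nonneg (fun j _ => (hU j).2.2) i
  have hup : ∀ i, q i ≤ (2 : ℝ) ^ e₂ * w i := by
    intro i
    by_cases hi : i ∈ B
    · rw [hq_def, hw_def, Set.indicator_of_mem hi, Set.indicator_of_mem hi]
      have hp := (hU i).2.2
      have := (rpow_weight_pinch hi.2.1 hi.2.2).2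
      nlinarith
    · rw [hq_def, hw_def, Set.indicator_of_notMem hi, Set.indicator_of_notMem hi, mul_zero]
  have hlow : ∀ i, (2 : ℝ) ^ e₁ * w i ≤ q i := by
    intro i
    by_cases hi : i ∈ B
    · rw [hq_def, hw_def, Set.indicator_of_mem hi, Set.indicator_of_mem hi]
      have hp := (hU i).2.2
      have := (rpow_weight_pinch hi.2.1 hi.2.2).1
      nlinarith
    · rw [hq_def, hw_def, Set.indicator_of_notMem hi, Set.indicator_of_notMem hi, mul_zero]
  have hqs : Summable q := Summable.of_nonneg_of_le hqnn hup (hW.mul_left _)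
  refine ⟨hqs, ?_, ?_⟩
  · unfold CrossingData.boxWeight CrossingData.boxCoeff
    rw [← tsum_mul_left]
    exact Summable.tsum_le_tsum hlow (hW.mul_left _) hqs
  · unfold CrossingData.boxWeight CrossingData.boxCoeff
    rw [← tsum_mul_left]
    exact Summable.tsum_le_tsum hup hqs (hW.mul_left _)

/-- **Assembly** (what `cover_eps.py` checks on exact rationals): a lower certificate `P_lo < W` with
`P_lo ≥ 0` and an upper certificate `W < P_hi` give `2^{e₁} P_lo < p_box < 2^{e₂} P_hi`. PROVED
(`W > 0` forces summability; then `boxCoeff_pinch`). [cite: RattazziEtAl2008, §5] -/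
theorem pBoxTwoSided_of_bounds {s G δ e₁ e₂ Plo Phi : ℝ} (hPlo : 0 ≤ Plo)
    (hlo : OpeEpsLowerA2D s G δ e₁ e₂ Plo) (hhi : OpeEpsUpperA2D s G δ e₁ e₂ Phi) :
    PBoxTwoSided s G δ e₁ e₂ ((2 : ℝ) ^ e₁ * Plo) ((2 : ℝ) ^ e₂ * Phi) := by
  intro D hU hC hS hT2
  have h1 := hlo D hU hC hS hT2
  have h2 := hhi D hU hC hS hT2
  have hWpos : 0 < D.boxWeight e₁ e₂ := lt_of_le_of_lt hPlo h1
  have hW : Summable ((D.boxSet e₁ e₂).indicator fun i => D.p i * (2 : ℝ) ^ (-D.Δ i)) := by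
    by_contra hns
    have : D.boxWeight e₁ e₂ = 0 := tsum_eq_zero_of_not_summable hns
    exact hWpos.ne' this
  obtain ⟨-, hle₁, hle₂⟩ := D.boxCoeff_pinch e₁ e₂ hU hW
  have hp₁ : (0 : ℝ) < (2 : ℝ) ^ e₁ := Real.rpow_pos_of_pos (by norm_num) _
  have hp₂ : (0 : ℝ) < (2 : ℝ) ^ e₂ := Real.rpow_pos_of_pos (by norm_num) _
  constructor
  · calc (2 : ℝ) ^ e₁ * Plo < (2 : ℝ) ^ e₁ * D.boxWeight e₁ e₂ := mul_lt_mul_of_pos_left h1 hp₁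
      _ ≤ D.boxCoeff e₁ e₂ := hle₁
  · calc D.boxCoeff e₁ e₂ ≤ (2 : ℝ) ^ e₂ * D.boxWeight e₁ e₂ := hle₂
      _ < (2 : ℝ) ^ e₂ * Phi := mul_lt_mul_of_pos_left h2 hp₂

/-- The same interval for the standard-normalisation datum `λ²_{σσ[box]} = 2 p_box`. Elementary.
[folklore] -/
theorem lambdaSqBox_bounds {s G δ e₁ e₂ lo hi : ℝ} (h : PBoxTwoSided s G δ e₁ e₂ lo hi)
    (D : CrossingData) (hU : D.IsUnitary) (hC : D.SatisfiesCrossing s)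
    (hS : D.ScalarsIn (Icc e₁ e₂ ∪ Ici G)) (hT2 : D.SpinTwoIn ({2} ∪ Ici (2 + δ))) :
    2 * lo < D.lambdaSqBox e₁ e₂ ∧ D.lambdaSqBox e₁ e₂ < 2 * hi := by
  obtain ⟨h1, h2⟩ := h D hU hC hS hT2
  unfold CrossingData.lambdaSqBox
  constructor <;> linarith

/-! ### The RB-6 rungs (numbers of `SCOPE.md` §4 `### controls-1 v14` ADDENDUM 1; CONTROL-ONLY) -/

/-- **RB-6, `ε`-OPE rung Λ = 11**: IF the two `ope2eps` certificates at Λ = 11, E₀ = 32 hold as typed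
statements (`P̃_lo = 124893/2000000`, kit j139947/j140872; `P̃_hi = 127743/2000000`, kit j139947; at
`Δ_σ = 1/8`, `ε` box `[197/200, 20001/20000]` = the lane's certified `ε` interval of `cover_v14.json`,
`G = 2`, `δ = 1`; each reader A 2.5.x arb AND reader B 2.4.x int PASS — external exact-arithmetic facts,
hypotheses here), then `2^{197/200} P̃_lo < p_box < 2^{20001/20000} P̃_hi` (`cover_eps_L11.json`:
`0.1236011 < p_box < 0.1277475`, `0.247202 < λ² < 0.255495`). [cite: RattazziEtAl2008, §5] -/
theorem pBoxTwoSided_rb6_L11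
    (hlo : OpeEpsLowerA2D (1 / 8) 2 1 (197 / 200) (20001 / 20000) (124893 / 2000000))
    (hhi : OpeEpsUpperA2D (1 / 8) 2 1 (197 / 200) (20001 / 20000) (127743 / 2000000)) :
    PBoxTwoSided (1 / 8) 2 1 (197 / 200) (20001 / 20000)
      ((2 : ℝ) ^ (197 / 200 : ℝ) * (124893 / 2000000)) ((2 : ℝ) ^ (20001 / 20000 : ℝ) * (127743 / 2000000)) :=
  pBoxTwoSided_of_bounds (by norm_num) hlo hhi

/-- **RB-6, `ε`-OPE rung Λ = 15 (the `ε`-OPE statement of record)**: IF the two `ope2eps` certificates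
at Λ = 15, E₀ = 40 of kit job j140872 hold as typed statements (`P̃_lo = 15621/250000`, cert
`3c11de69…`; `P̃_hi = 319051/5000000`, cert `9e123389…`; `Δ_σ = 1/8`, `ε` box `[197/200, 20001/20000]`,
`G = 2`, `δ = 1`; reader A 2.5.1 arb AND reader B 2.4.1 int PASS each — external facts, hypotheses
here), then `2^{197/200} · 15621/250000 < p_box < 2^{20001/20000} · 319051/5000000`
(`cover_eps_L15.json`: `0.1236754 < p_box < 0.1276249`, `0.2473508 < λ²_{σσ[box]} < 0.2552497`;
2D Ising truth `p_ε = 1/8`, `λ² = 1/4` inside). [cite: RattazziEtAl2008, §5] -/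
theorem pBoxTwoSided_rb6_L15
    (hlo : OpeEpsLowerA2D (1 / 8) 2 1 (197 / 200) (20001 / 20000) (15621 / 250000))
    (hhi : OpeEpsUpperA2D (1 / 8) 2 1 (197 / 200) (20001 / 20000) (319051 / 5000000)) :
    PBoxTwoSided (1 / 8) 2 1 (197 / 200) (20001 / 20000)
      ((2 : ℝ) ^ (197 / 200 : ℝ) * (15621 / 250000)) ((2 : ℝ) ^ (20001 / 20000 : ℝ) * (319051 / 5000000)) :=
  pBoxTwoSided_of_bounds (by norm_num) hlo hhi

/-! ### Decimal sanity: outer rational bounds for the two `2^e` factors -/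

/-- `2^{197/200} > 1.9793` (exact check `1.9793^200 < 2^197`). [folklore] -/
theorem two_rpow_e1_lower : (19793 : ℝ) / 10000 < (2 : ℝ) ^ (197 / 200 : ℝ) := by
  have h2 : (0 : ℝ) ≤ (2 : ℝ) ^ (197 / 200 : ℝ) := by positivity
  have hpow : ((2 : ℝ) ^ (197 / 200 : ℝ)) ^ (200 : ℕ) = (2 : ℝ) ^ (197 : ℕ) := by
    rw [← Real.rpow_natCast, ← Real.rpow_mul (by norm_num : (0 : ℝ) ≤ 2)]
    norm_num
  by_contra hnot
  have hle : (2 : ℝ) ^ (197 / 200 : ℝ) ≤ 19793 / 10000 := not_lt.mp hnot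
  have := pow_le_pow_left₀ h2 hle 200
  rw [hpow] at this
  norm_num at this

/-- `2^{20001/20000} < 2.00007`: `2^{1/20000} = exp(log 2 / 20000) < 1/(1 - log 2/20000)` and
`log 2 < 0.6931471808`. [folklore] -/
theorem two_rpow_e2_upper : (2 : ℝ) ^ (20001 / 20000 : ℝ) < 200007 / 100000 := by
  have h2 : (0 : ℝ) < 2 := by norm_num
  have hsplit : (2 : ℝ) ^ (20001 / 20000 : ℝ) = 2 * (2 : ℝ) ^ (1 / 20000 : ℝ) := by
    rw [show (20001 / 20000 : ℝ) = 1 + 1 / 20000 by norm_num, Real.rpow_add h2, Real.rpow_one]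
  rw [hsplit, Real.rpow_def_of_pos h2]
  have hlog := Real.log_two_lt_d9
  have hlogpos : 0 < Real.log 2 := Real.log_pos (by norm_num)
  set x := Real.log 2 * (1 / 20000 : ℝ) with hx
  have hx0 : 0 < x := by positivity
  have hx1 : x < 1 := by rw [hx]; nlinarith
  have hexp := Real.exp_bound_div_one_sub_of_interval' hx0 hx1
  have hden : 0 < 1 - x := by linarith
  have hbound : 1 / (1 - x) ≤ 1 / (1 - 0.6931471808 * (1 / 20000 : ℝ)) := by
    apply one_div_le_one_div_of_le
    · norm_num
    · nlinarith
  calc 2 * Real.exp x < 2 * (1 / (1 - x)) := by nlinarith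
    _ ≤ 2 * (1 / (1 - 0.6931471808 * (1 / 20000 : ℝ))) := by nlinarith
    _ < 200007 / 100000 := by norm_num

/-- **Decimal form of the Λ = 15 rung** (CONTROL-ONLY): the typed `ε`-OPE statement of record implies
`0.123674 < p_box < 0.127625`, i.e. `0.247348 < λ²_{σσ[box]} = 2 p_box < 0.25525`, and the 2D Ising
values `p_ε = 1/8`, `λ²_{σσε} = 1/4` lie inside. [folklore] -/
theorem pBoxTwoSided_rb6_L15_decimal
    (h : PBoxTwoSided (1 / 8) 2 1 (197 / 200) (20001 / 20000)
      ((2 : ℝ) ^ (197 / 200 : ℝ) * (15621 / 250000)) ((2 : ℝ) ^ (20001 / 20000 : ℝ) * (319051 / 5000000))) :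
    PBoxTwoSided (1 / 8) 2 1 (197 / 200) (20001 / 20000) (123674 / 1000000) (127625 / 1000000) ∧
      (123674 / 1000000 : ℝ) < 1 / 8 ∧ (1 / 8 : ℝ) < 127625 / 1000000 := by
  refine ⟨h.mono ?_ ?_, by norm_num, by norm_num⟩
  · have := two_rpow_e1_lower
    nlinarith
  · have := two_rpow_e2_upper
    nlinarith

end Summit.CriticalPhenomena.Ising3D.Control2D
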